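import Summits.HodgeConjecture.CorCM.PointwiseConjugationSlots
import HarnessLib

/-!
# POINTWISE partial conjugations, the converse: a pair without a pointwise conjugation produces a common constituent
# of the odd weights — the criterion is exact

COR-CM (cell `pub-hodgecm2`, binder seat `b16` gen 48, count-neutral claim PTCONJ, file F1b — the abstract `G`-set
level, converse half; theorems only, no definition, no named fact, no `sorry`).  NEW as stated, hence under `Summits/`.
HONEST FRAMING: a representation-theoretic lemma about families of CM types; `HC_CM` is neither used nor asserted.

Sequel of `Summits/HodgeConjecture/CorCM/PointwiseConjugationSlots` (setting and notation there: `G` acting slot by slot,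
conjugation `ρ`, odd weights `Anti(X)`, antisymmetric spans `U(Φ)`; the theorem there: if every pair `(x, y) ∈ X × Y`
admits `g ∈ G` with `g x = ρ x`, `g y = y`, the two slots have no common constituent).  Here the CONVERSE:

> **Theorem** (`exists_common_constituent_of_not_pointwiseConj`).  If some pair `(x₀, y₀) ∈ X × Y` admits no `g ∈ G`
> with `g x₀ = ρ x₀` and `g y₀ = y₀`, then there are a non-zero `G`-stable `P ≤ Anti(X)` and a linear
> `T : ℚ^X → ℚ^Y`, equivariant, mapping `Anti(X)` into `Anti(Y)`, injective on `P` — a common constituent of the odd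
> weights of the two slots.

Hence for NONDEGENERATE types (`U(Φ_i) = Anti(E_i)`, `U(Φ_j) = Anti(E_j)`) the hypothesis `hpair` of
`map_slotExt_antiSpan_le_of_pairwise` holds **iff** the pointwise condition holds (`pairwise_iff_pointwiseConj`,
`not_pairwise_of_not_pointwiseConj`): the pairwise route to additivity is closed exactly when a pointwise conjugation
is missing — additivity may then still hold, but only through the POSITION of the type vectors inside the common
constituent (as for the reflex pairs of non-Galois quartic CM fields, `DihedralReflexPairCMHodge`).

PROOF.  Mackey's basis of `Hom_G(ℚ^X, ℚ^Y)`: with `c(x, y) = [ (x, y) ∈ G·(x₀, y₀) ]` the ORBIT OPERATOR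
`(Tf)(y) = Σ_x c(x, y) f(x)` commutes with precomposition by `G` (`c(g⁻¹x, y) = c(x, gy)`), maps odd weights to odd
weights (`c(ρx, ρy) = c(x, y)`), and `T(δ_{x₀} − δ_{ρx₀})(y₀) = c(x₀, y₀) − c(ρx₀, y₀) = 1 − 0` precisely because
`(ρx₀, y₀) ∉ G·(x₀, y₀)` (`exists_orbitOperator`).  Then `K = Anti(X) ∩ ker T` is stable, `P = Anti(X) ∩ K^⊥` is stable
(invariant dot product), non-zero (else `δ_{x₀} − δ_{ρx₀} ∈ K`), and `T` is injective on `P` (`P ∩ K = 0`).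

## References

* [Serre1977] J.-P. Serre, *Linear Representations of Finite Groups*, GTM 42, §7.3–7.4 (induced representations,
  Frobenius reciprocity, Mackey: intertwiners of permutation modules from double cosets).
* [Gordon1999HodgeAVSurvey] B. B. Gordon, *A survey of the Hodge conjecture for abelian varieties*, §3 Theorem (Imai,
  Murty) with proof; 7.5–7.7 (degenerate products).
* [Kubota1965] T. Kubota, *On the field extension by complex multiplication*, Trans. AMS 118 (1965), §2 (the odd part of
  the group ring generated by a type).
-/

set_option autoImplicit false

noncomputable section

open scoped BigOperators

namespace Summit.HodgeConjecture.CorCM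

namespace PointwiseConj

open Literature.NumberTheory.ComplexMultiplication

variable {G : Type*} [Group G]

/-! ### §4 The converse: a pair without a pointwise conjugation produces a common constituent of the odd weights -/

section Converse

variable {X Y : Type*} [MulAction G X] [MulAction G Y] [Fintype X] [DecidableEq X] {ρ : G}

omit [Fintype X] [DecidableEq X] in
/-- The `ρ`-odd weights are `G`-stable when `ρ` commutes with `G` on `X`. [cite: Kubota1965, §2 (p. 115)] -/
theorem comp_smul_mem_antiWeights (hcomm : ∀ (g : G) (x : X), g • ρ • x = ρ • g • x) {f : X → ℚ}
    (hf : f ∈ antiWeights (E := X) ρ) (g : G) : (fun x => f (g • x)) ∈ antiWeights (E := X) ρ := by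
  rw [mem_antiWeights_iff'] at hf ⊢
  intro x
  simp only [hcomm, hf]

/-- **The orbit operator of a pair `(x₀, y₀)`.**  `(T f)(y) = Σ_x [ (x, y) ∈ G·(x₀, y₀) ] · f(x)` is a linear map
`ℚ^X → ℚ^Y` commuting with precomposition by `G` and mapping `ρ`-odd weights to `ρ`-odd weights; at the odd vector
`δ_{x₀} − δ_{ρx₀}` and the point `y₀` its value is `1 − [ (ρx₀, y₀) ∈ G·(x₀, y₀) ]` (Mackey's basis of
`Hom_G(ℚ^X, ℚ^Y)` indexed by the orbits of `G` on `X × Y`). [cite: Serre1977, §7.3–7.4] -/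
theorem exists_orbitOperator (x₀ : X) (y₀ : Y) :
    ∃ T : (X → ℚ) →ₗ[ℚ] (Y → ℚ),
      (∀ (g : G) (f : X → ℚ), T (fun x => f (g • x)) = fun y => T f (g • y)) ∧
      (∀ f ∈ antiWeights (E := X) ρ, T f ∈ antiWeights (E := Y) ρ) ∧
      ((¬ ∃ g : G, g • x₀ = ρ • x₀ ∧ g • y₀ = y₀) →
        T (Pi.single x₀ (1 : ℚ) - Pi.single (ρ • x₀) 1) y₀ = 1) := by
  classical
  -- the orbit indicator `c x y = [ ∃ g, g x₀ = x ∧ g y₀ = y ]`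
  set c : X → Y → ℚ := fun x y => if ∃ g : G, g • x₀ = x ∧ g • y₀ = y then 1 else 0 with hc_def
  have hcg : ∀ (g : G) (x : X) (y : Y), c (g⁻¹ • x) y = c x (g • y) := by
    intro g x y
    have hiff : (∃ k : G, k • x₀ = g⁻¹ • x ∧ k • y₀ = y) ↔ ∃ k : G, k • x₀ = x ∧ k • y₀ = g • y := by
      constructor
      · rintro ⟨k, hkx, hky⟩
        exact ⟨g * k, by rw [mul_smul, hkx, smul_inv_smul], by rw [mul_smul, hky]⟩
      · rintro ⟨k, hkx, hky⟩
        exact ⟨g⁻¹ * k, by rw [mul_smul, hkx], by rw [mul_smul, hky, inv_smul_smul]⟩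
    simp only [hc_def, hiff]
  have hcρ : ∀ (x : X) (y : Y), c (ρ • x) (ρ • y) = c x y := by
    intro x y
    have hiff : (∃ k : G, k • x₀ = ρ • x ∧ k • y₀ = ρ • y) ↔ ∃ k : G, k • x₀ = x ∧ k • y₀ = y := by
      constructor
      · rintro ⟨k, hkx, hky⟩
        exact ⟨ρ⁻¹ * k, by rw [mul_smul, hkx, inv_smul_smul], by rw [mul_smul, hky, inv_smul_smul]⟩
      · rintro ⟨k, hkx, hky⟩
        exact ⟨ρ * k, by rw [mul_smul, hkx], by rw [mul_smul, hky]⟩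
    simp only [hc_def, hiff]
  -- the operator
  let T : (X → ℚ) →ₗ[ℚ] (Y → ℚ) :=
    { toFun := fun f y => ∑ x, c x y * f x
      map_add' := fun f f' => by
        funext y
        simp only [Pi.add_apply, mul_add, Finset.sum_add_distrib]
      map_smul' := fun a f => by
        funext y
        simp only [Pi.smul_apply, smul_eq_mul, RingHom.id_apply, Finset.mul_sum]
        refine Finset.sum_congr rfl fun x _ => ?_
        ring }
  have hT : ∀ (f : X → ℚ) (y : Y), T f y = ∑ x, c x y * f x := fun _ _ => rfl
  refine ⟨T, fun g f => ?_, fun f hf => ?_, fun hnot => ?_⟩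
  · funext y
    rw [hT, hT]
    -- reindex `x ↦ g⁻¹ x` on the left
    have h1 : ∑ x, c x y * f (g • x) = ∑ x, c (g⁻¹ • x) y * f x := by
      refine Fintype.sum_equiv (MulAction.toPerm g) _ _ fun x => ?_
      change c x y * f (g • x) = c (g⁻¹ • g • x) y * f (g • x)
      rw [inv_smul_smul]
    rw [h1]
    exact Finset.sum_congr rfl fun x _ => by rw [hcg]
  · rw [mem_antiWeights_iff'] at hf ⊢
    intro y
    rw [hT, hT]
    have h1 : ∑ x, c x (ρ • y) * f x = ∑ x, c (ρ • x) (ρ • y) * f (ρ • x) :=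
      (Fintype.sum_equiv (MulAction.toPerm ρ) (fun x => c (ρ • x) (ρ • y) * f (ρ • x))
        (fun x => c x (ρ • y) * f x) fun _ => rfl).symm
    rw [h1, ← Finset.sum_neg_distrib]
    refine Finset.sum_congr rfl fun x _ => ?_
    rw [hcρ, hf, mul_neg]
  · rw [hT]
    have h1 : ∀ x, c x y₀ * (Pi.single x₀ (1 : ℚ) - Pi.single (ρ • x₀) 1 : X → ℚ) x =
        (if x = x₀ then c x y₀ else 0) - if x = ρ • x₀ then c x y₀ else 0 := by
      intro x
      simp only [Pi.sub_apply, Pi.single_apply, mul_sub, mul_ite, mul_one, mul_zero]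
    simp only [h1, Finset.sum_sub_distrib, Finset.sum_ite_eq', Finset.mem_univ, if_true]
    have h2 : c x₀ y₀ = 1 := by
      simp only [hc_def]
      rw [if_pos ⟨1, one_smul _ _, one_smul _ _⟩]
    have h3 : c (ρ • x₀) y₀ = 0 := by
      simp only [hc_def]
      rw [if_neg hnot]
    rw [h2, h3, sub_zero]

/-- **Converse: no pointwise conjugation at `(x₀, y₀)` ⟹ a common constituent of the odd weights.**  If no `g ∈ G`
has `g x₀ = ρ x₀` and `g y₀ = y₀`, there are a non-zero `G`-stable `P ≤ Anti(X)` and a linear `T : ℚ^X → ℚ^Y`,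
equivariant, mapping `Anti(X)` into `Anti(Y)`, injective on `P` (the orbit operator of `(x₀, y₀)` on
`P = Anti(X) ∩ (Anti(X) ∩ ker T)^⊥`). [cite: Serre1977, §7.3–7.4] -/
theorem exists_common_constituent_of_not_pointwiseConj
    (hcomm : ∀ (g : G) (x : X), g • ρ • x = ρ • g • x) (hinv : ∀ x : X, ρ • ρ • x = x)
    {x₀ : X} {y₀ : Y} (hnot : ¬ ∃ g : G, g • x₀ = ρ • x₀ ∧ g • y₀ = y₀) :
    ∃ P : Submodule ℚ (X → ℚ), P ≤ antiWeights (E := X) ρ ∧ P ≠ ⊥ ∧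
      (∀ g : G, ∀ f ∈ P, (fun x => f (g • x)) ∈ P) ∧
      ∃ T : (X → ℚ) →ₗ[ℚ] (Y → ℚ),
        (∀ (g : G) (f : X → ℚ), T (fun x => f (g • x)) = fun y => T f (g • y)) ∧
        (∀ f ∈ antiWeights (E := X) ρ, T f ∈ antiWeights (E := Y) ρ) ∧
        ∀ f ∈ P, T f = 0 → f = 0 := by
  obtain ⟨T, hTeq, hTodd, hTval⟩ := exists_orbitOperator (G := G) (ρ := ρ) x₀ y₀
  have hval := hTval hnot
  -- `K = Anti ∩ ker T` is stable; `P = Anti ∩ K^⊥`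
  set A : Submodule ℚ (X → ℚ) := antiWeights (E := X) ρ with hA_def
  set K : Submodule ℚ (X → ℚ) := A ⊓ LinearMap.ker T with hK_def
  have hAst : ∀ g : G, ∀ f ∈ A, (fun x => f (g • x)) ∈ A := fun g f hf => comp_smul_mem_antiWeights hcomm hf g
  have hKst : ∀ g : G, ∀ f ∈ K, (fun x => f (g • x)) ∈ K := by
    intro g f hf
    refine ⟨hAst g f hf.1, LinearMap.mem_ker.2 ?_⟩
    rw [hTeq g f, LinearMap.mem_ker.1 hf.2]
    rfl
  set Q : Submodule ℚ (X → ℚ) := LinearMap.BilinForm.orthogonal (dotProductBilin ℚ ℚ) K with hQ_def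
  have hc : IsCompl K Q := isCompl_orthogonal K
  refine ⟨A ⊓ Q, inf_le_left, ?_, fun g f hf => ⟨hAst g f hf.1, comp_smul_mem_orthogonal hKst hf.2 g⟩,
    T, hTeq, hTodd, fun f hf hf0 => ?_⟩
  · -- non-zero: otherwise the odd vector `δ_{x₀} − δ_{ρx₀}` would lie in `ker T`
    intro hbot
    set f₀ : X → ℚ := Pi.single x₀ (1 : ℚ) - Pi.single (ρ • x₀) 1 with hf₀_def
    have hf₀A : f₀ ∈ A := single_sub_single_mem_antiWeights hinv x₀
    -- decompose `f₀ = p + q` along `K ⊕ Q`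
    obtain ⟨p, hp, q, hq, hpq⟩ := Submodule.mem_sup.1 (by rw [hc.sup_eq_top]; exact Submodule.mem_top : f₀ ∈ K ⊔ Q)
    have hqA : q ∈ A := by
      have : q = f₀ - p := by rw [← hpq]; abel
      rw [this]
      exact A.sub_mem hf₀A hp.1
    have hq0 : q = 0 := by
      have : q ∈ A ⊓ Q := ⟨hqA, hq⟩
      rw [hbot] at this
      exact (Submodule.mem_bot ℚ).1 this
    rw [hq0, add_zero] at hpq
    have h1 : T f₀ = 0 := by rw [← hpq]; exact LinearMap.mem_ker.1 hp.2
    have h2 := congrFun h1 y₀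
    rw [hval, Pi.zero_apply] at h2
    exact one_ne_zero h2
  · -- injective on `P`: `f ∈ K ∩ K^⊥ = 0`
    have hfK : f ∈ K := ⟨hf.1, LinearMap.mem_ker.2 hf0⟩
    have : f ∈ K ⊓ Q := ⟨hfK, hf.2⟩
    rw [hc.inf_eq_bot] at this
    exact (Submodule.mem_bot ℚ).1 this

/-- **For NONDEGENERATE types the pairwise criterion is unavailable without a pointwise conjugation**: if
`U(Φ_i) = Anti(E_i)` and `U(Φ_j) = Anti(E_j)` and some pair `(x₀, y₀)` admits no `g` with `g x₀ = ρ x₀`, `g y₀ = y₀`,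
then the hypothesis `hpair` of `map_slotExt_antiSpan_le_of_pairwise` FAILS for `(i, j)` — a non-zero stable
`P ≤ U(Φ_i)` with an equivariant `T` injective on `P` into `U(Φ_j)` exists.  (Additivity may still hold: it is then a
matter of the POSITION of the type vectors, as for the reflex pairs of non-Galois quartic CM fields.)
[cite: Serre1977, §7.3–7.4] [cite: Gordon1999HodgeAVSurvey, 7.5] -/
theorem not_pairwise_of_not_pointwiseConj {I : Type*} {E : I → Type*} [∀ i, MulAction G (E i)]
    {Φ : ∀ i, Set (E i)} (h : ∀ i, IsCMTypeWith ρ (Φ i)) {i j : I}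
    [Fintype (E i)] [Fintype (E j)] [DecidableEq (E i)] [DecidableEq (E j)]
    (hUi : antiSpan G (Φ i) = antiWeights (E := E i) ρ) (hUj : antiSpan G (Φ j) = antiWeights (E := E j) ρ)
    {x₀ : E i} {y₀ : E j} (hnot : ¬ ∃ g : G, g • x₀ = ρ • x₀ ∧ g • y₀ = y₀) :
    ¬ ∀ P : Submodule ℚ (E i → ℚ), P ≤ antiSpan G (Φ i) →
      (∀ g : G, ∀ f ∈ P, (fun x => f (g • x)) ∈ P) →
      ∀ T : (E i → ℚ) →ₗ[ℚ] (E j → ℚ),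
        (∀ g : G, ∀ f ∈ P, T (fun x => f (g • x)) = fun y => T f (g • y)) →
        (∀ f ∈ P, T f ∈ antiSpan G (Φ j)) → (∀ f ∈ P, T f = 0 → f = 0) → P = ⊥ := by
  intro hpair
  obtain ⟨P, hPA, hP0, hPst, T, hTeq, hTodd, hTinj⟩ :=
    exists_common_constituent_of_not_pointwiseConj (h i).comm (h i).invol hnot
  refine hP0 (hpair P (by rw [hUi]; exact hPA) hPst T (fun g f _ => hTeq g f) (fun f hf => ?_) hTinj)
  rw [hUj]
  exact hTodd f (hPA hf)

/-- **The exact criterion, nondegenerate types.**  For `U(Φ_i) = Anti(E_i)`, `U(Φ_j) = Anti(E_j)`: the slots have no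
common constituent (order `i → j`) **iff** every pair `(x, y)` admits `g ∈ G` with `g x = ρ x`, `g y = y`.
[cite: Serre1977, §7.3–7.4] [cite: Gordon1999HodgeAVSurvey, §3 Theorem and 7.5] -/
theorem pairwise_iff_pointwiseConj {I : Type*} {E : I → Type*} [∀ i, MulAction G (E i)]
    {Φ : ∀ i, Set (E i)} (h : ∀ i, IsCMTypeWith ρ (Φ i)) {i j : I}
    [Fintype (E i)] [Fintype (E j)] [DecidableEq (E i)] [DecidableEq (E j)]
    (hUi : antiSpan G (Φ i) = antiWeights (E := E i) ρ) (hUj : antiSpan G (Φ j) = antiWeights (E := E j) ρ) :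
    (∀ P : Submodule ℚ (E i → ℚ), P ≤ antiSpan G (Φ i) →
      (∀ g : G, ∀ f ∈ P, (fun x => f (g • x)) ∈ P) →
      ∀ T : (E i → ℚ) →ₗ[ℚ] (E j → ℚ),
        (∀ g : G, ∀ f ∈ P, T (fun x => f (g • x)) = fun y => T f (g • y)) →
        (∀ f ∈ P, T f ∈ antiSpan G (Φ j)) → (∀ f ∈ P, T f = 0 → f = 0) → P = ⊥) ↔
    ∀ (x : E i) (y : E j), ∃ g : G, g • x = ρ • x ∧ g • y = y := by
  constructor
  · intro hpair x y
    by_contra hnot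
    exact not_pairwise_of_not_pointwiseConj h hUi hUj hnot hpair
  · intro hpt
    exact (pairwise_of_pointwiseConj h hpt).1

end Converse

end PointwiseConj

end Summit.HodgeConjecture.CorCM

end
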